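import Summits.BirchSwinnertonDyer.BirchSwinnertonDyer.Theorems.SignedLowerHalvesSmallImageLowerHalfBothSignsRttCharRoadE2HKOfRoadD
import HarnessLib

/-!
# Route `SignedLowerHalves`, crux L `SmallImageLowerHalfBothSigns` (stmt-BirchSwinnertonDyer-23599), line `rtt_w3` v14 — E2, road-D frame:
# `hreg` IS A CONSEQUENCE OF `hdef` + `Thm52Shape` (an `f`-torsion-free finitely generated torsion module has characteristic ideal prime to `f`),
# so the binder `hreg` of `charRoad_E2_of_roadD_junction(_exact)` LEAVES the input list

WHY (BRIEF-E2 rev 4 §2–§3, `Lines/rtt_w3-BRIEF-E2-g10.md`; LEAD `cruxlead-stmt-BirchSwinnertonDyer-23599` g11). The road-D frame of the E2 glue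
(`SmallImageRttCharRoad.charRoad_E2_of_roadD_junction_exact`, p780454) carries two hypotheses on the `f = C (X − C b)`-torsion of the two-variable
carriers: the DEFECT hypothesis `hdef : (H1 ⧸ D.Z)[f] = 0` (row (4′), supplied by p777666 from `hTF` + `eH ζ̄ ≠ 0`) and the REGULARITY hypothesis
`hreg : ¬ char_R(H2) ≤ (f)` (the specialised characteristic series `φ(char H2)` is non-zero). THIS FILE proves `hdef ⟹ hreg` given `Thm52Shape`
(`char_R(H2) = char_R(H1 ⧸ D.Z)`, `H1 ⧸ D.Z` torsion): for a finitely generated torsion module `M` over a Noetherian domain `R` and a prime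
element `f` with `M[f] = 0`, one has `¬ char_R(M) ≤ (f)` — a non-zero annihilator `s = fⁿ·s'` (`f ∤ s'`, `WfDvdMonoid.max_power_factor`) gives the
annihilator `s' ∉ (f)` (peel off `fⁿ` using `M[f] = 0`), so `M_{(f)} = 0` (`lengthAt_eq_zero_of_isTorsionBy`) while `char(M) ≤ (f)` would force
`M_{(f)} ≠ 0` (`LocalLength.lengthAt_ne_zero_of_charIdeal_le`, `(f)` of height one). `f = C (X − C b)` is prime because `ker φ = (f)` for the inner
evaluation `φ : 𝒪⟦T₂⟧⟦T₁⟧ → 𝒪⟦T⟧` into a domain.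

* `smul_eq_zero_of_pow_mul_smul_eq_zero` — peel `fⁿ` off an annihilator on an `f`-torsion-free module;
* ★ `not_charIdeal_le_span_singleton_of_torsionBy_eq_bot` — the generic statement (`R` Noetherian domain, `f` prime, `M` f.g. torsion, `M[f] = 0`);
* `C_X_sub_C_ne_zero`, `prime_of_ker_eq_span` — `f ≠ 0`; `ker φ = (f)` into a domain ⟹ `f` prime;
* ★★ `not_charIdeal_le_span_of_thm52Shape_of_torsionBy_eq_bot` — `hreg` of the road-D frame from `hdef` + `Thm52Shape` + `hker`;
* ★★★★ `charRoad_E2_of_roadD_junction_exact_of_torsionBy_eq_bot` — p780454's `charRoad_E2_of_roadD_junction_exact` WITHOUT the binder `hreg`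
  (every other binder byte-identical, same order).

THEOREMS ONLY (`--supports stmt-BirchSwinnertonDyer-23599` helper); closes nothing; crux L, crux M, E2 and BSD remain OPEN and are proved for
NO curve by any of this.
[cite: BourbakiAC5to7, Ch. VII §4 no. 4 Thm. 3 and no. 5 Prop. 10 (characteristic ideal via lengths at height-one primes)] [cite: Washington1997, §13.2]
[cite: JohnsonLeungKings2011, Thm. 5.2, Cor. 5.3 (arXiv p0014:L114–133, p0015:L1–20)]
-/

set_option autoImplicit false
-- the Theorems namespace of this sub repeats the summit name by design (D-0017 nested layout)
set_option linter.dupNamespace false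

noncomputable section
open scoped Pointwise Classical MatrixGroups ModularForm

open PowerSeries Literature.NumberTheory.Automorphic Literature.NumberTheory.EllipticCurves Literature.NumberTheory.EllipticCurves.Module
open Literature.NumberTheory.ComplexMultiplication.EllipticUnits.JohnsonLeungKings2011
open Summit.BirchSwinnertonDyer.BirchSwinnertonDyer.Theorems.SignedBaseChangeAcDivSpecialization.LocalLength (lengthAt_ne_zero_of_charIdeal_le)
open Summit.BirchSwinnertonDyer.BirchSwinnertonDyer.Theorems.SmallImageRttD2LamSpec
open Literature.NumberTheory.IwasawaTheory Literature.NumberTheory.EllipticCurves.GreenbergVatsal2000 CongruenceSubgroup NumberField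
  IsDedekindDomain Rat.HeightOneSpectrum Literature.NumberTheory.EllipticCurves.ModularForms

namespace Summit.BirchSwinnertonDyer.BirchSwinnertonDyer.Theorems.SmallImageRttCharRoad

universe u v w w'

/-! ## §1 An `f`-torsion-free finitely generated torsion module has characteristic ideal prime to `f` -/

section Generic

variable {R : Type u} [CommRing R] {M : Type v} [AddCommGroup M] [Module R M]

/-- Peeling `fⁿ` off an annihilator on an `f`-torsion-free module: `(fⁿ·s')·m = 0 ⟹ s'·m = 0`. [folklore] -/
theorem smul_eq_zero_of_pow_mul_smul_eq_zero {f : R} (hf : ∀ x : M, f • x = 0 → x = 0) (n : ℕ) {s' : R} {m : M}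
    (h : (f ^ n * s') • m = 0) : s' • m = 0 := by
  induction n with
  | zero => simpa only [pow_zero, one_mul] using h
  | succ n ih =>
    apply ih
    apply hf
    rw [← mul_smul, ← mul_assoc, ← pow_succ']
    exact h

/-- ★ **An `f`-torsion-free finitely generated torsion module has characteristic ideal prime to `f`.** `R` a Noetherian domain, `f ∈ R` prime,
`M` finitely generated and torsion with `M[f] = 0`: then `¬ char_R(M) ⊆ (f)`. Proof: a non-zero annihilator `s = fⁿ·s'` with `f ∤ s'` yields the
annihilator `s' ∉ (f)`, so `M_{(f)} = 0`, i.e. `length_{(f)}(M) = 0`; but `(f)` has height one and `char(M) ⊆ (f)` forces `length_{(f)}(M) ≠ 0`.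
[cite: BourbakiAC5to7, Ch. VII §4 no. 4 Thm. 3, no. 5 Prop. 10] [cite: Washington1997, §13.2] -/
theorem not_charIdeal_le_span_singleton_of_torsionBy_eq_bot [IsNoetherianRing R] [IsDomain R] [Module.Finite R M]
    (hM : Module.IsTorsion R M) {f : R} (hf : Prime f) (hdef : Submodule.torsionBy R M f = ⊥) :
    ¬ charIdeal R M ≤ Ideal.span {f} := by
  -- one non-zero annihilator of `M`
  obtain ⟨s, hsann, hs0⟩ := Submodule.annihilator_top_inter_nonZeroDivisors hM
  have hs : s ≠ 0 := nonZeroDivisors.ne_zero hs0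
  have hsM : ∀ m : M, s • m = 0 := fun m ↦ Submodule.mem_annihilator.mp hsann m Submodule.mem_top
  -- strip its `f`-part
  obtain ⟨n, s', hfs', rfl⟩ := WfDvdMonoid.max_power_factor hs hf.irreducible
  have hfinj : ∀ x : M, f • x = 0 → x = 0 := fun x hx ↦ by
    have hx' : x ∈ Submodule.torsionBy R M f := (Submodule.mem_torsionBy_iff f x).mpr hx
    rw [hdef] at hx'
    exact (Submodule.mem_bot R).mp hx'
  have hs'M : Module.IsTorsionBy R M s' := fun m ↦ smul_eq_zero_of_pow_mul_smul_eq_zero hfinj n (hsM m)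
  -- the height-one prime `(f)`
  let 𝔮 : PrimeSpectrum R := ⟨Ideal.span {f}, (Ideal.span_singleton_prime hf.ne_zero).mpr hf⟩
  have h𝔮 : 𝔮.asIdeal.height = 1 := height_span_singleton_eq_one_of_prime hf
  have hh : s' ∉ 𝔮.asIdeal := fun h ↦ hfs' (Ideal.mem_span_singleton.mp h)
  intro hle
  exact lengthAt_ne_zero_of_charIdeal_le h𝔮 hle (lengthAt_eq_zero_of_isTorsionBy hs'M 𝔮 hh)

/-- `ker φ = (f)` for a ring map into a domain, `f ≠ 0` ⟹ `f` is prime. [folklore] -/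
theorem prime_of_ker_eq_span [IsDomain R] {S' : Type w} [CommRing S'] [IsDomain S'] (φ : R →+* S') {f : R} (hf0 : f ≠ 0)
    (hker : RingHom.ker φ = Ideal.span {f}) : Prime f := by
  rw [← Ideal.span_singleton_prime hf0, ← hker]
  exact RingHom.ker_isPrime φ

end Generic

/-! ## §2 The road-D frame: `hreg` from `hdef` + `Thm52Shape` -/

section Frame

variable (p : ℕ) [Fact p.Prime] (S : Set (PadicAlgCl p)) [FiniteDimensional ℚ_[p] (padicCoeffField S)]

omit [FiniteDimensional ℚ_[p] (padicCoeffField S)] in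
/-- `C (X − C b) ≠ 0` in `𝒪⟦T₂⟧⟦T₁⟧` (its `T₂`-coefficient of degree one is `1`). [folklore] -/
theorem C_X_sub_C_ne_zero (b : padicCoeffIntegers S) : (C (X - C b) : PowerSeries (IwasawaAlgebraO S)) ≠ 0 := by
  intro h
  have h1 : (X - C b : IwasawaAlgebraO S) = 0 := by
    have := congrArg (PowerSeries.constantCoeff) h
    simpa only [PowerSeries.constantCoeff_C, map_zero] using this
  have h2 := congrArg (PowerSeries.coeff 1) h1
  simp only [map_sub, PowerSeries.coeff_one_X, PowerSeries.coeff_C, one_ne_zero, ↓reduceIte, sub_zero, map_zero] at h2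

/-- ★★ **`hreg` of the road-D frame from `hdef` + `Thm52Shape`.** In -w3 g19's coordinates (`R = 𝒪⟦T₂⟧⟦T₁⟧`, `f = C (X − C b)`, inner evaluation
`φ` with `ker φ = (f)`, a `ZetaSkeleton` `D` with `D.Thm52Shape`): if `(H1 ⧸ D.Z)[f] = 0` (`hdef`, row (4′)) then `¬ char_R(H2) ≤ (f)` (`hreg`).
[cite: JohnsonLeungKings2011, Thm. 5.2 (arXiv p0014:L114–133)] [cite: BourbakiAC5to7, Ch. VII §4 no. 5 Prop. 10] -/
theorem not_charIdeal_le_span_of_thm52Shape_of_torsionBy_eq_bot (b : padicCoeffIntegers S)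
    (φ : PowerSeries (IwasawaAlgebraO S) →+* IwasawaAlgebraO S) (hker : RingHom.ker φ = Ideal.span {C (X - C b)})
    {Aidx H0 H1 H2 : Type v} [AddCommGroup H0] [Module (PowerSeries (IwasawaAlgebraO S)) H0] [AddCommGroup H1]
    [Module (PowerSeries (IwasawaAlgebraO S)) H1] [AddCommGroup H2] [Module (PowerSeries (IwasawaAlgebraO S)) H2]
    [Module.Finite (PowerSeries (IwasawaAlgebraO S)) H1]
    (D : ZetaSkeleton (PowerSeries (IwasawaAlgebraO S)) Aidx H0 H1 H2) (h52 : D.Thm52Shape)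
    (hdef : Submodule.torsionBy (PowerSeries (IwasawaAlgebraO S)) (H1 ⧸ D.Z) (C (X - C b)) = ⊥) :
    ¬ charIdeal (PowerSeries (IwasawaAlgebraO S)) H2 ≤ Ideal.span {(C (X - C b) : PowerSeries (IwasawaAlgebraO S))} := by
  haveI : IsDiscreteValuationRing (padicCoeffIntegers S) := by
    rw [padicCoeffIntegers_eq_unitBall S]; exact LambdaLowerBoundO.isDiscreteValuationRing_unitBall p _
  haveI : IsNoetherianRing (PowerSeries (IwasawaAlgebraO S)) := inferInstance
  obtain ⟨⟨-, -, htorsA, -⟩, hchar⟩ := h52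
  have hprime : Prime (C (X - C b) : PowerSeries (IwasawaAlgebraO S)) := prime_of_ker_eq_span φ (C_X_sub_C_ne_zero p S b) hker
  rw [show charIdeal (PowerSeries (IwasawaAlgebraO S)) H2 = charIdeal (PowerSeries (IwasawaAlgebraO S)) (H1 ⧸ D.Z) from hchar.symm]
  exact not_charIdeal_le_span_singleton_of_torsionBy_eq_bot htorsA hprime hdef

end Frame

/-! ## §3 E2 from road D + the junction WITHOUT `hreg` -/

section E2

variable {p : ℕ} [Fact p.Prime] {S : Set (PadicAlgCl p)} [Algebra (IwasawaAlgebra p) (IwasawaAlgebraO S)]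

set_option maxHeartbeats 400000 in -- same budget line as p780454's `charRoad_E2_of_roadD_junction_exact` (one extra `have`)
/-- ★★★★ **E2 from road D through the junction, exactness form, WITHOUT `hreg`.** p780454's `charRoad_E2_of_roadD_junction_exact` with the
frame binder `hreg : ¬ char_R(H2) ≤ (f)` DISCHARGED from `hdef` + `h52` + `hker` (§2); every other binder byte-identical and in the same order.
Remaining research binders: the junction (`B`, `s`, `htB`, `hcoker`, `j₀`, `hexact`, `hjz`, `hY`), the defect `hdef` (⟸ `hTF`, p777666), `Col`/`hCol`
(rows (5′)/(7′)), and the data `z`, `hz` (in v15: `z := j₀ (s ζ̄)`). [cite: Kobayashi2003, Thm. 7.3 i)] [cite: JohnsonLeungKings2011, Thm. 5.2, Cor. 5.3]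
[cite: Washington1997, §13.2] -/
theorem charRoad_E2_of_roadD_junction_exact_of_torsionBy_eq_bot (hS : 0 < Module.finrank ℚ_[p] (padicCoeffField S))
    (halg : ∀ r : IwasawaAlgebra p, algebraMap (IwasawaAlgebra p) (IwasawaAlgebraO S) r = iwasawaToIwasawaO S r)
    {M : ℕ} [NeZero M] (g : CuspForm (Gamma0 M) 2) (ι : coeffField g →+* PadicAlgCl p) (hng : IsNewform0 g)
    (S₀ : Finset (HeightOneSpectrum (𝓞 ℚ)))
    {Q X' : Type} [AddCommGroup Q] [AddCommGroup X'] [Module (IwasawaAlgebraO S) Q] [Module (IwasawaAlgebra p) Q]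
    [IsScalarTower (IwasawaAlgebra p) (IwasawaAlgebraO S) Q] [Module (IwasawaAlgebraO S) X'] [Module (IwasawaAlgebra p) X']
    [IsScalarTower (IwasawaAlgebra p) (IwasawaAlgebraO S) X'] [Module.Finite (IwasawaAlgebra p) X'] (hX' : Module.IsTorsion (IwasawaAlgebra p) X')
    (gX : Q →ₗ[IwasawaAlgebraO S] X') (z : Q) (hz : gX z = 0) (b : padicCoeffIntegers S) (φ : PowerSeries (IwasawaAlgebraO S) →+* IwasawaAlgebraO S)
    (hφf : φ (C (X - C b)) = 0) (hC : ∀ a : padicCoeffIntegers S, φ (C (C a)) = C a) (hX : φ X = X)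
    (hker : RingHom.ker φ = Ideal.span {C (X - C b)})
    {Aidx H0 H1 H2 : Type v} [AddCommGroup H0]
    [Module (PowerSeries (IwasawaAlgebraO S)) H0] [AddCommGroup H1] [Module (PowerSeries (IwasawaAlgebraO S)) H1] [AddCommGroup H2]
    [Module (PowerSeries (IwasawaAlgebraO S)) H2] [Module.Finite (PowerSeries (IwasawaAlgebraO S)) H1]
    [Module.Finite (PowerSeries (IwasawaAlgebraO S)) H2]
    (D : ZetaSkeleton (PowerSeries (IwasawaAlgebraO S)) Aidx H0 H1 H2) (h52 : D.Thm52Shape)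
    (hdef : Submodule.torsionBy (PowerSeries (IwasawaAlgebraO S)) (H1 ⧸ D.Z) (C (X - C b)) = ⊥)
    [Module (IwasawaAlgebraO S) (QuotSMulTop (C (X - C b) : PowerSeries (IwasawaAlgebraO S)) H1)]
    (hιH : ∀ (l : IwasawaAlgebraO S) (x : QuotSMulTop (C (X - C b) : PowerSeries (IwasawaAlgebraO S)) H1),
      l • x = (PowerSeries.map (PowerSeries.C : padicCoeffIntegers S →+* IwasawaAlgebraO S) l) • x)
    [Module (IwasawaAlgebra p) (QuotSMulTop (C (X - C b) : PowerSeries (IwasawaAlgebraO S)) H1)]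
    [IsScalarTower (IwasawaAlgebra p) (IwasawaAlgebraO S) (QuotSMulTop (C (X - C b) : PowerSeries (IwasawaAlgebraO S)) H1)]
    [Module (IwasawaAlgebra p) (Submodule.torsionBy (PowerSeries (IwasawaAlgebraO S)) H2 (C (X - C b)))]
    (hΛT : ∀ (r : IwasawaAlgebra p) (x : Submodule.torsionBy (PowerSeries (IwasawaAlgebraO S)) H2 (C (X - C b))),
      r • x = (PowerSeries.map (PowerSeries.C : padicCoeffIntegers S →+* IwasawaAlgebraO S) (iwasawaToIwasawaO S r)) • x)
    [Module (IwasawaAlgebra p) (QuotSMulTop (C (X - C b) : PowerSeries (IwasawaAlgebraO S)) H2)]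
    (hΛ2 : ∀ (r : IwasawaAlgebra p) (x : QuotSMulTop (C (X - C b) : PowerSeries (IwasawaAlgebraO S)) H2),
      r • x = (PowerSeries.map (PowerSeries.C : padicCoeffIntegers S →+* IwasawaAlgebraO S) (iwasawaToIwasawaO S r)) • x)
    (ζ : QuotSMulTop (C (X - C b) : PowerSeries (IwasawaAlgebraO S)) H1) (hζ : (D.Z).map ((C (X - C b) : PowerSeries (IwasawaAlgebraO S)) • (⊤ : Submodule (PowerSeries (IwasawaAlgebraO S)) H1)).mkQ =
      Submodule.span (PowerSeries (IwasawaAlgebraO S)) {ζ})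
    {B : Type w} [AddCommGroup B] [Module (IwasawaAlgebraO S) B] [Module (IwasawaAlgebra p) B] [IsScalarTower (IwasawaAlgebra p) (IwasawaAlgebraO S) B]
    (s : QuotSMulTop (C (X - C b) : PowerSeries (IwasawaAlgebraO S)) H1 →ₗ[IwasawaAlgebraO S] B)
    [Module.Finite (IwasawaAlgebra p) (B ⧸ LinearMap.range s)] (htB : Module.IsTorsion (IwasawaAlgebra p) (B ⧸ LinearMap.range s))
    (hcoker : lambdaInvariant p (B ⧸ LinearMap.range s) ≤ lambdaInvariant p (Submodule.torsionBy (PowerSeries (IwasawaAlgebraO S)) H2 (C (X - C b))))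
    (j₀ : B →ₗ[IwasawaAlgebraO S] Q) (hexact : Function.Exact j₀ gX) (hjz : j₀ (s ζ) = z)
    (hY : lambdaInvariant p (QuotSMulTop (C (X - C b) : PowerSeries (IwasawaAlgebraO S)) H2) ≤ lambdaInvariant p (X' ⧸ LinearMap.range gX))
    (Col : Q ≃ₗ[IwasawaAlgebraO S] IwasawaAlgebraO S) (L : IwasawaAlgebraO (Set.range ι)) (hL : L ≠ 0) {c : PadicAlgCl p} (hc : c ≠ 0)
    (fv : HeightOneSpectrum (𝓞 ℚ) → ℤ_[p]) (hfv : ∀ v ∈ S₀, fv v ≠ 0 ∧ (fv v).valuation = (frobeniusExponent p (natGenerator v : ℤ_[p])).valuation)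
    (hCol : iwasawaOToPowerSeries S (Col z) =
      PowerSeries.C c * iwasawaOToPowerSeries (Set.range ι) L *
        ∏ v ∈ S₀, Polynomial.aeval (PowerSeries.C ((natGenerator v : PadicAlgCl p)⁻¹) *
            (PowerSeries.binomialSeries ℤ_[p] (fv v)).map (algebraMap ℤ_[p] (PadicAlgCl p)))
          (1 - Polynomial.C (embCoeff g ι (natGenerator v)) * Polynomial.X +
            (if natGenerator v ∣ M then 0 else Polynomial.C (natGenerator v : PadicAlgCl p)) * Polynomial.X ^ 2)) :
    ∃ d : ℕ, (∀ k : ℕ, ‖PowerSeries.coeff k (iwasawaOToPowerSeries (Set.range ι) L)‖ ≤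
        ‖PowerSeries.coeff d (iwasawaOToPowerSeries (Set.range ι) L)‖) ∧
      (∀ k : ℕ, k < d → ‖PowerSeries.coeff k (iwasawaOToPowerSeries (Set.range ι) L)‖ <
        ‖PowerSeries.coeff d (iwasawaOToPowerSeries (Set.range ι) L)‖) ∧
      Module.finrank ℚ_[p] (padicCoeffField S) * (d + ∑ v ∈ S₀, p ^ (frobeniusExponent p (natGenerator v : ℤ_[p])).valuation *
        layerLambda ((1 - Polynomial.C (embCoeff g ι (natGenerator v)) * Polynomial.X +
          (if natGenerator v ∣ M then 0 else Polynomial.C (natGenerator v : PadicAlgCl p)) * Polynomial.X ^ 2).comp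
            (Polynomial.C ((natGenerator v : PadicAlgCl p)⁻¹) * (Polynomial.X + 1)))) ≤ lambdaInvariant p X' := by
  haveI : FiniteDimensional ℚ_[p] (padicCoeffField S) := Module.finite_of_finrank_pos hS
  exact charRoad_E2_of_roadD_junction_exact hS halg g ι hng S₀ hX' gX z hz b φ hφf hC hX hker D h52
    (not_charIdeal_le_span_of_thm52Shape_of_torsionBy_eq_bot p S b φ hker D h52 hdef) hdef hιH hΛT hΛ2 ζ hζ s htB hcoker j₀ hexact hjz hY
    Col L hL hc fv hfv hCol

end E2

end Summit.BirchSwinnertonDyer.BirchSwinnertonDyer.Theorems.SmallImageRttCharRoad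

end
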